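import Summits.RiemannHypothesis.RiemannHypothesis.Theorems.Splittings.LinearRayOnePointCoverDefs
import Summits.RiemannHypothesis.RiemannHypothesis.Theorems.Splittings.LinearRayOnePointCheck

/-!
# Soundness of the window (multi-box) one-point check (cell rh-split, C15 / S-dbn-1)

`boxesCheck_get`, `linRayCoverCheckWith_some` (context a VARIABLE ⇒ no kernel reduction of the closed context),
**`linRayCoverCheck_sound`: a passing `linRayCoverCheck pt As AD sc` refutes the linear-factor ray for every
`a ∈ [As[0]/AD, As[last]/AD]`** (box location by `UniversalFactor.osa_cover_find`, then `pointCheck_sound` and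
`LinearRayOnePoint.not_linearRay_of_onePoint`).
HONEST LABEL: machinery refuting an RH-STRENGTHENING conjunct (the linear-factor ray of
`Literature/Barriers/RiemannHypothesis/NewmanConjecture.lean`); RH-free; nothing here bears on the truth of RH.
Provenance: rh-splitx-eng-5 g3 (cell rh-split, D-0116 arm; C15 / S-dbn-1 filler → kernel), monolith
`HOME/rh-splitx-eng-5/ray/LinearRayOnePointMono-v3.lean`.
-/

set_option linter.dupNamespace false

noncomputable section

namespace Summit.RiemannHypothesis.RiemannHypothesis.Theorems.Splittings.LinearRayOnePoint

open MeasureTheory Set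
open Literature.NumberTheory.LFunctions
open Literature.Analysis.ValidatedNumerics Literature.Analysis.ValidatedNumerics.NumericsMP
open Literature.Barriers.RiemannHypothesis (linearFactorH hasOnlyRealZeros_linearFactorH_neg_iff)
open Summit.RiemannHypothesis.RiemannHypothesis.Theorems

/-- Every box below `n` passed. [folklore] -/
theorem boxesCheck_get {C : UniversalFactor.OsaCtx} {pt : UniversalFactor.OsaPoint} {hx hpx : MI} {vF : Array MI}
    {As : List ℕ} {AD sc : ℕ} :
    ∀ n : ℕ, boxesCheck C pt hx hpx vF As AD sc n = true →
      ∀ k < n, As.getD k 0 < As.getD (k + 1) 0 ∧ pointCheck C pt hx hpx vF (As.getD k 0) (As.getD (k + 1) 0) AD sc = true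
  | 0, _, k, hk => absurd hk (Nat.not_lt_zero _)
  | n + 1, h, k, hk => by
      simp only [boxesCheck, Bool.and_eq_true, decide_eq_true_eq] at h
      obtain ⟨hrec, hlt', hlast⟩ := h
      rcases Nat.lt_succ_iff_lt_or_eq.1 hk with hlt | heq
      · exact boxesCheck_get n hrec k hlt
      · subst heq; exact ⟨hlt', hlast⟩

/-- A passing parametrised window check exposes its context and its data. [folklore] -/
theorem linRayCoverCheckWith_some {oc : Option UniversalFactor.OsaCtx} {pt : UniversalFactor.OsaPoint}
    {As : List ℕ} {AD sc : ℕ} (h : linRayCoverCheckWith oc pt As AD sc = true) :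
    ∃ C, oc = some C ∧
      (0 < AD ∧ 0 < As.getD 0 0 ∧ 2 ≤ As.length ∧ 0 < C.rhoUn ∧ 0 < C.rhoUd ∧ 0 < C.RUd ∧
        4 * C.RUn ≤ C.RUd ∧ C.rhoUn * C.RUd < C.RUn * C.rhoUd ∧ 1 ≤ C.Nth ∧ C.phiTab.size = 32 * C.Cu) ∧
      pt.ok = true ∧
      ∃ hx hpx vF, UniversalFactor.osaH0 C pt.xn pt.xd = some hx ∧ evalH0D C pt.xn pt.xd = some hpx ∧
        UniversalFactor.osaNodeVals C pt false (32 * pt.CyF) 0 #[] = some vF ∧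
        boxesCheck C pt hx hpx vF As AD sc (As.length - 1) = true := by
  cases oc with
  | none => exact absurd h Bool.false_ne_true
  | some C =>
    refine ⟨C, rfl, ?_⟩
    simp only [linRayCoverCheckWith, Bool.and_eq_true, decide_eq_true_eq] at h
    obtain ⟨⟨hcond, hok⟩, hdata⟩ := h
    refine ⟨hcond, hok, ?_⟩
    split at hdata
    · rename_i hx hpx vF hhx hhpx hvF
      exact ⟨hx, hpx, vF, hhx, hhpx, hvF, hdata⟩
    · exact absurd hdata Bool.false_ne_true

/-- **Soundness of the window check**: if `linRayCoverCheck pt As AD sc` passes, the linear-factor ray is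
refuted for every `a` of the window `[As[0]/AD, As[last]/AD]`. [folklore] -/
theorem linRayCoverCheck_sound {pt : UniversalFactor.OsaPoint} {As : List ℕ} {AD sc : ℕ}
    (h : linRayCoverCheck pt As AD sc = true) {a : ℝ}
    (ha1 : (As.getD 0 0 : ℝ) / AD ≤ a) (ha2 : a ≤ (As.getD (As.length - 1) 0 : ℝ) / AD) :
    ¬ HasOnlyRealZeros (linearFactorH a) :=
  have hsome := linRayCoverCheckWith_some h
  hsome.elim fun C hC => by
    obtain ⟨hmk, ⟨hAD, hA0, hlen, hrho, hrhod, hRd, hR4, hρR, hN, -⟩, hok, hx, hpx, vF, hhx, hhpx, hvF, hboxes⟩ := hC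
    have hV : C.Valid := UniversalFactor.valid_of_mkOsaCtx hmk (by norm_num) (by norm_num) (by norm_num)
      (by norm_num) (by norm_num) (by norm_num) (by norm_num)
    obtain ⟨hxd, hyn, hyd, -, -, -⟩ := (UniversalFactor.OsaPoint.ok_iff pt).1 hok
    have hhx' := UniversalFactor.mem_osaH0 hV hxd hhx
    have hhpx' := mem_evalH0D hV hxd hhpx
    have hvF' := UniversalFactor.osaNodeVals_inv hV pt hxd hyd false (32 * pt.CyF) 0 #[] hvF rfl
      (fun i' hi' => absurd hi' (by omega))
    simp only [zero_add, Bool.false_eq_true, ↓reduceIte] at hvF'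
    obtain ⟨k, hk, hk1, hk2⟩ := UniversalFactor.osa_cover_find As AD a ha1 (As.length - 1) (by omega) ha2
    obtain ⟨hlt, hchk⟩ := boxesCheck_get (As.length - 1) hboxes k hk
    have hAk : 0 < As.getD k 0 := by
      -- As[0] > 0 and the breakpoints increase along the checked boxes
      have hmono : ∀ j ≤ k, As.getD 0 0 ≤ As.getD j 0 := by
        intro j hj
        induction j with
        | zero => exact le_rfl
        | succ j ih =>
          have := (boxesCheck_get (As.length - 1) hboxes j (by omega)).1
          exact (ih (by omega)).trans this.le
      exact lt_of_lt_of_le hA0 (hmono k le_rfl)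
    have hC := pointCheck_sound hV pt hok hhx' hhpx' hvF'.2 hAk hAD hchk hk1 hk2
    have ha0 : 0 < a := lt_of_lt_of_le (by positivity) hk1
    exact not_linearRay_of_onePoint ha0 (by positivity) hC

end Summit.RiemannHypothesis.RiemannHypothesis.Theorems.Splittings.LinearRayOnePoint

end
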